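import Mathlib.Order.Directed
import Mathlib.Data.Set.Image
import Mathlib.Data.Set.Subsingleton

/-!
# Inverse systems whose images become singletons ([SemiAnbd] Thm. 3.7 (iii), Comments (6)(b))

Mochizuki, *Semi-graphs of Anabelioids*, Publ. RIMS **42** (2006) 221–322, Theorem 3.7 (iii)
[cite: MochizukiSemiAnbd2006, Thm. 3.7(iii) p.41], in the form of the author's *Comments* (May
2020), item (6)(b): with `E_i` the set of closed edges of the tree `𝒢_{i,∞}` fixed by the compact
subgroup `H` and `E_{j,i} ⊆ E_j` the image of `E_i` (`i ≥ j`), "it follows from (∗_j) that each of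
the nonempty sets `E_{j,i}`, for `i` sufficiently large relative to `j`, is of cardinality 1.  But
this implies that each intersection `E_{j,∞} := ⋂_{i ≥ j} E_{j,i}` is of cardinality 1.  Thus, the
unique elements of the `E_{j,∞}` form a compatible system of closed edges fixed by `H`."

This proof-only file isolates that step as pure inverse-system combinatorics (no semi-graphs), a
companion of `TreeSystemFixedPoint.exists_compatible_of_finite`: for a directed inverse system of
sets `X_j` with transition maps `φ`, and subsets `F_j ⊆ X_j` (the fixed closed edges) that are
NONEMPTY, stable under `φ`, and such that for every `j` some image `φ(F_i)` (`i ≥ j`) has at most one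
element (condition (∗_j)), there is a compatible family `x_j ∈ F_j`, and it is unique.

* `exists_compatible_of_eventually_subsingleton_image` — existence;
* `compatible_unique_of_eventually_subsingleton_image` — uniqueness.
-/

namespace Literature.AnabelianGeometry.SemiGraphs

namespace SemiGraph

universe u v

/-- **Compatible system from eventually-singleton images** (Comments (6)(b) on Thm. 3.7 (iii)):
in a directed inverse system of sets, nonempty `φ`-stable subsets `F_j` whose images `φ(F_i) ⊆ F_j`
have at most one element for some `i ≥ j` (for every `j`) admit a compatible family of elements
`x_j ∈ F_j` — `x_j` is the unique element of `E_{j,∞} = ⋂_{i ≥ j} φ(F_i)`.  Only the composition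
law of the transition maps is used. [cite: MochizukiSemiAnbd2006, Thm. 3.7(iii) p.41] -/
theorem exists_compatible_of_eventually_subsingleton_image {J : Type u} [Preorder J]
    [IsDirectedOrder J] {X : J → Type v} (φ : ∀ ⦃i j : J⦄, i ≤ j → X j → X i)
    (φ_comp : ∀ ⦃i j k : J⦄ (hij : i ≤ j) (hjk : j ≤ k) (x : X k),
      φ hij (φ hjk x) = φ (hij.trans hjk) x)
    (F : ∀ j, Set (X j)) (hne : ∀ j, (F j).Nonempty)
    (hmap : ∀ ⦃i j : J⦄ (h : i ≤ j) (x : X j), x ∈ F j → φ h x ∈ F i)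
    (hstar : ∀ j, ∃ (i : J) (h : j ≤ i), (φ h '' F i).Subsingleton) :
    ∃ x : ∀ j, X j, (∀ j, x j ∈ F j) ∧ ∀ ⦃i j : J⦄ (h : i ≤ j), φ h (x j) = x i := by
  classical
  -- for each `j`, a level `ι j ≥ j` beyond which the images in `F j` are a single point
  choose ι hι hsub using hstar
  -- an element of that image: the future `x j`
  choose y hy using fun j => hne (ι j)
  let x : ∀ j, X j := fun j => φ (hι j) (y j)
  have hxS : ∀ j, x j ∈ φ (hι j) '' F (ι j) := fun j => ⟨y j, hy j, rfl⟩
  -- images from any level above `ι j` lie in that single-point image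
  have hA : ∀ (j k : J) (hk : ι j ≤ k) (z : X k), z ∈ F k →
      φ ((hι j).trans hk) z ∈ φ (hι j) '' F (ι j) := by
    intro j k hk z hz
    exact ⟨φ hk z, hmap hk z hz, φ_comp (hι j) hk z⟩
  -- hence `x j` lies in EVERY image `φ(F i)`, `i ≥ j`
  have hP : ∀ (j i : J) (h : j ≤ i), x j ∈ φ h '' F i := by
    intro j i h
    obtain ⟨k, hik, hιk⟩ := exists_ge_ge i (ι j)
    obtain ⟨z, hz⟩ := hne k
    have hw : φ ((hι j).trans hιk) z = x j := hsub j (hA j k hιk z hz) (hxS j)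
    refine ⟨φ hik z, hmap hik z hz, ?_⟩
    rw [φ_comp h hik z]
    exact hw
  refine ⟨x, fun j => hmap (hι j) (y j) (hy j), fun i j h => ?_⟩
  -- compatibility: `φ (x j)` and `x i` both lie in the single-point image at `i`
  obtain ⟨k, hjk, hιk⟩ := exists_ge_ge j (ι i)
  obtain ⟨z, hz, hzx⟩ := hP j k hjk
  rw [← hzx, φ_comp h hjk z]
  exact hsub i (hA i k hιk z hz) (hxS i)

/-- Uniqueness in the same situation: two compatible families of elements of the `F_j` coincide
("`E_{j,∞}` is of cardinality 1"). [cite: MochizukiSemiAnbd2006, Thm. 3.7(iii) p.41] -/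
theorem compatible_unique_of_eventually_subsingleton_image {J : Type u} [Preorder J]
    {X : J → Type v} (φ : ∀ ⦃i j : J⦄, i ≤ j → X j → X i)
    (F : ∀ j, Set (X j))
    (hstar : ∀ j, ∃ (i : J) (h : j ≤ i), (φ h '' F i).Subsingleton)
    (x x' : ∀ j, X j) (hx : ∀ j, x j ∈ F j) (hx' : ∀ j, x' j ∈ F j)
    (hcx : ∀ ⦃i j : J⦄ (h : i ≤ j), φ h (x j) = x i)
    (hcx' : ∀ ⦃i j : J⦄ (h : i ≤ j), φ h (x' j) = x' i) : x = x' := by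
  funext j
  obtain ⟨i, h, hsub⟩ := hstar j
  rw [← hcx h, ← hcx' h]
  exact hsub ⟨x i, hx i, rfl⟩ ⟨x' i, hx' i, rfl⟩

end SemiGraph

end Literature.AnabelianGeometry.SemiGraphs
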